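import Summits.HodgeConjecture.HodgeConjecture.Theorems.Ring2AtlasWeilCarriersEESplitSixfolds
import Literature.AlgebraicGeometry.HodgeTheory.WeilClassesConiveauTransfer
import HarnessLib

/-!
# Ring 2 · motiv (generation 23) — the general Hodge conjecture (coniveau 1) for the Weil Hodge structure of an
abelian fourfold of `K`-signature `(3,1)`, with the hyperbolicity hypothesis of Prop. G31 DISCHARGED

HONEST FRAMING (cell `pub-hodge-ring2`, seat `motiv`, verbatim): research route conditional on HC_CM; not a
corollary; Q11.4-sentence-2 already refuted in dim ≥ 3. `HC_CM` (:= `Theses.RankFourFaces.CMAbelianHodge`) occurs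
NOWHERE in this file: every theorem below is either unconditional or takes ONE printed sixfold theorem as a
NAMED-FACT hypothesis (`(hK : Koike2004_…)` refereed, `(hS : Schoen1998_…)` refereed, `(hM : Markman2025_…)`
UNREFEREED), exactly as the rest of the layer does. No named fact is introduced or discharged; nothing derived by the
cell is entered as a fact.

WHAT WAS OPEN. Prop. G31 of the seat's section (`Literature/…/WeilClassesConiveauTransfer.lean`,
`weilClassesOf_fourfold_le_supportedClasses_one_of_{koike, schoen1998, markman}`): for an abelian fourfold `Y` with
`K = ℚ(√-d)` acting by `φ` (`φ² = -d`) and a surface `B` with `ψ² = -d`, IF the sixfold `(Y × B, φ × ψ)` is of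
HYPERBOLIC Weil type for some `K`-symmetrised hyperplane class (explicit hypothesis `hhyp`, together with the
embedding `e` and the rational class `a`), then the printed sixfold theorem gives
`weilClassesOf Y φ 2 d ⊆ N¹ H⁴(Y(ℂ); ℂ)` by the coniveau transfer (Grothendieck 1969 p. 301 / Abdulali). The
hyperbolicity of `Y × E'²` was recorded there as "a discriminant computation NOT carried out in this file".

WHAT THIS FILE PROVES (kernel, 0 sorry; the new content is glue — the two load-bearing inputs are cited by name and
COUNTED ONCE: the AbelianAll seat's `isSplitWeilType_odd_prod_curve` (p205880: every Weil-type `A × E` with `dim A`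
odd is split, by the weighted Segre polarisation, van Geemen 5.2 (4) and Landherr) through atlas-2's re-association
`weilAlgebraicFor_three_fourfold_prod_curve_sq_of_{koike, schoen, markmanSixfolds}` (p206442 §1–§2)):

* §1 (unconditional) `exists_cmCurve_eigenMultiplicity_eq`: for every `d ≥ 1` and `k ≤ 1` there is a CM curve
  `(E₀, ψ₀)`, `ψ₀² = -d`, on whose `H^{1,0}` the eigenvalue `i√d` of `ψ₀^*` has multiplicity `k` (the curve of
  `exists_cmCurve_sqrt_neg`, with `ψ₀` or `-ψ₀`); `exists_isWeilType_fourfold31_prod_cmSquare`: for `Y` a fourfold with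
  `φ² = -d` of `K`-SIGNATURE `(3,1)` — the multiplicity of `i√d` on `H^{1,0}(Y)` is `3` or `1` — there is such a curve
  with `(Y × (E₀ × E₀), φ × (ψ₀ × ψ₀))` of Weil type `(3,3)` (multiplicities add over products,
  `eigenMultiplicity_prodLift`; `m_Y + 2k = 3`).
* §2 (unconditional) `weilClassesOf_le_algebraicClasses_of_weilAlgebraicFor`: on a Weil-type pair the POINTWISE
  statement "every rational `(n,n)` Weil class is algebraic" (`WeilAlgebraicFor`, the shape of the printed facts) gives
  the SUBMODULE statement "the complexified Weil plane consists of algebraic classes" (the shape consumed by the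
  coniveau transfer) — `weilClassesOf_le_algebraicClasses_of_forall_isRationalClass` fed with `IsWeilType.multiplicity_eq`.
* §3 `weilClassesOf_fourfold_le_supportedClasses_one_of_{koike, schoen1998, markman}_of_isWeilType`: Prop. G31 with
  `hhyp`, `e`, `a` REPLACED by the Weil-type `(3,3)` condition on `(Y × (E₀ × E₀), φ × (ψ₀ × ψ₀))`, `E₀` a curve.
* §4 HEADLINE `weilClassesOf_fourfold31_le_supportedClasses_one_of_{koike, schoen1998, markman}`: for EVERY abelian
  fourfold `Y` with `K = ℚ(√-d)` acting with signature `(3,1)`,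
  `weilClassesOf Y φ 2 d ⊆ N¹ H⁴(Y(ℂ); ℂ)` — the general Hodge conjecture (as corrected by Grothendieck) for the Weil
  Hodge structure `W_K(Y)` (Hodge types `{(3,1), (1,3)}`, predicted coniveau exactly `1`) — granted ONLY
  Koike 2004 (`d = 1`, refereed), resp. Schoen 1998 (`d = 3`, refereed), resp. Markman's F2 (any `d`, UNREFEREED).
  No hyperbolicity, embedding, partner-curve or Hodge-group hypothesis remains.

PRINT STATUS (numbers, not adjectives). `K = ℚ(i)`: known in print (Schoen 1989, cyclic covers; Abdulali 2016 §8.2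
case 1) — §4 is a second proof on the carriers from Koike 2004 Cor. 2.1. `K = ℚ(√-3)`: the surveyed print literature
(Abdulali 2016 §8.2 and Appendix A; Voisin 2025 §4.1) records no proof of this case of the general Hodge conjecture;
§4 decides it in the kernel from ONE refereed input (Schoen 1998 §§10–13 with Schoen 1988 Thm. 3.0). Other `K`: from
ONE unrefereed input (Markman arXiv:2502.03415 Thm. 1.5.1). The statements are about the layer's real carriers
(`weilClassesOf`, `supportedClasses`, `algebraicClasses`); PROVENANCE: each is the COMPOSITION of the cited printed
steps and of the named tree theorems, not itself a numbered result of the sources.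

## References
* [GrothendieckTopology1969] A. Grothendieck, Hodge's general conjecture is false for trivial reasons, Topology 8
  (1969), p. 301. [Abdulali2016TateTwists] S. Abdulali, LMS LN 427 (2016), Prop. 3.2, §8.2 (p. 298), Appendix A.
* [Koike2004WeilHodge] K. Koike, Canad. Math. Bull. 47 (2004), Thm. 2.1 and Cor. 2.1.
  [Schoen1998HodgeWeilAddendum] C. Schoen, Compositio Math. 114 (1998), §§10–13. [Schoen1988HodgeWeil] Compositio 65 (1988).
* [Markman2025SecantWeil] E. Markman, arXiv:2502.03415, Thm. 1.5.1 (UNREFEREED).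
* [vanGeemen1994HodgeAV] B. van Geemen, LNM 1594 (1994), 4.9–4.10, Lemma 5.2 (1)–(4), 5.3, 5.4 and (5.4.1), Thm. 6.12.
* [MoonenZarhin1998WeilClasses] Duke Math. J. 77 / J. reine angew. Math. 496, §1 (the multiplicities `n_σ`).
* [LangeBirkenhake1992] §1.1 (p. 19). [SilvermanAEC2009] Thm. VI.4.1 (b). [Landherr1936HermitianForms].
-/

set_option linter.dupNamespace false

noncomputable section

open CategoryTheory

namespace Summit.HodgeConjecture.HodgeConjecture.Ring2.Motiv

open Literature.AlgebraicGeometry Literature.AlgebraicGeometry.Motives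
open Literature.AlgebraicGeometry.HodgeTheory
open Literature.AlgebraicTopology.SingularHomology
open Summit.HodgeConjecture.HodgeConjecture.Ring2.Hypotheses
open Summit.HodgeConjecture.HodgeConjecture.Ring2.Atlas
open Summit.HodgeConjecture.HodgeConjecture.Cruxes.HodgeAbelianVarieties.EStepSecantInduction (WeilAlgebraicFor)

/-! ## §1 Balancing CM curves for a fourfold of signature `(3,1)` (unconditional) -/

section Balancing

/-- **A CM curve with prescribed `i√d`-multiplicity.** For `d ≥ 1` and `k ≤ 1` there is an elliptic curve `E₀` with
an endomorphism `ψ₀`, `ψ₀ ≫ ψ₀ = -d`, such that `i√d` has multiplicity `k` on `H^{1,0}(E₀)`: the curve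
`ℂ/(ℤ + ℤ√-d)` of `exists_cmCurve_sqrt_neg` carries `ψ₀` with `m(ψ₀) + m(-ψ₀) = dim E₀ = 1`
(`eigenMultiplicity_add_eigenMultiplicity_neg_eq_dim`, `eigenMultiplicity_neg`), so `ψ₀` or `-ψ₀` does it.
[cite: SilvermanAEC2009, Thm. VI.4.1 (b)] [cite: vanGeemen1994HodgeAV, 5.3] [cite: LangeBirkenhake1992, §1.1 (p. 19)] -/
theorem exists_cmCurve_eigenMultiplicity_eq (d : ℕ) (hd : 0 < d) {k : ℕ} (hk : k ≤ 1) :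
    ∃ (E₀ : AbelianVariety ℂ) (ψ₀ : E₀ ⟶ E₀), E₀.dim = 1 ∧ ψ₀ ≫ ψ₀ = -(d • 𝟙 E₀) ∧
      eigenMultiplicity E₀ ψ₀ (Complex.I * (Real.sqrt d : ℂ)) = k := by
  obtain ⟨E₀, ψ₁, hE, hψ₁⟩ :=
    Literature.NumberTheory.EllipticCurves.CMEndomorphism.exists_cmCurve_sqrt_neg d hd
  have hsum := eigenMultiplicity_add_eigenMultiplicity_neg_eq_dim E₀ ψ₁ hd hψ₁
  rw [hE] at hsum
  have hneg : (-ψ₁) ≫ (-ψ₁) = -(d • 𝟙 E₀) := by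
    rw [Preadditive.neg_comp, Preadditive.comp_neg, neg_neg, hψ₁]
  have hflip := eigenMultiplicity_neg ψ₁ (Complex.I * (Real.sqrt d : ℂ))
  by_cases h0 : eigenMultiplicity E₀ ψ₁ (Complex.I * (Real.sqrt d : ℂ)) = k
  · exact ⟨E₀, ψ₁, hE, hψ₁, h0⟩
  · refine ⟨E₀, -ψ₁, hE, hneg, ?_⟩
    rw [hflip]
    omega

variable {Y : AbelianVariety ℂ} {d : ℕ} {φ : Y ⟶ Y}

/-- **A Weil-type `(3,3)` completion `Y × E₀²` of a fourfold of `K`-signature `(3,1)`.** Let `Y` be an abelian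
fourfold with `φ ≫ φ = -d`, `d ≥ 1`, such that `i√d` has multiplicity `3` or `1` on `H^{1,0}(Y)` (`K = ℚ(√-d)` acts
with signature `(3,1)`; the two cases are exchanged by `φ ↦ -φ`). Then there is a CM curve `(E₀, ψ₀)`, `ψ₀² = -d`, with
`(Y × (E₀ × E₀), φ × (ψ₀ × ψ₀))` of Weil type `(3,3)`: take `ψ₀` of multiplicity `k` with `m_Y + 2k = 3` (§1) and add
multiplicities over the product (`eigenMultiplicity_prodLift`; `isWeilType_of_eigenMultiplicity_eq`). This is
Deligne's CM padding `E × Ē` / Schoen's and Abdulali's dominating variety `Y × E'²` for the Weil structure `W_K(Y)`.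
[cite: Deligne1982HodgeCycles, §5 (c)] [cite: Abdulali2016TateTwists, §8.2 (p. 298)]
[cite: vanGeemen1994HodgeAV, 4.9–4.10 and 5.3] [cite: LangeBirkenhake1992, §1.1 (p. 19)] -/
theorem exists_isWeilType_fourfold31_prod_cmSquare (hd : 0 < d) (hY : Y.dim = 4) (hφ : φ ≫ φ = -(d • 𝟙 Y))
    (h31 : eigenMultiplicity Y φ (Complex.I * (Real.sqrt d : ℂ)) = 3 ∨
      eigenMultiplicity Y φ (Complex.I * (Real.sqrt d : ℂ)) = 1) :
    ∃ (E₀ : AbelianVariety ℂ) (ψ₀ : E₀ ⟶ E₀), E₀.dim = 1 ∧ ψ₀ ≫ ψ₀ = -(d • 𝟙 E₀) ∧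
      IsWeilType (Y.prod (E₀.prod E₀))
        (AbelianVariety.prodLift (AbelianVariety.fst Y (E₀.prod E₀) ≫ φ)
          (AbelianVariety.snd Y (E₀.prod E₀) ≫
            AbelianVariety.prodLift (AbelianVariety.fst E₀ E₀ ≫ ψ₀) (AbelianVariety.snd E₀ E₀ ≫ ψ₀))) 3 d := by
  -- the balancing multiplicity `k` with `m_Y + 2k = 3`
  obtain ⟨k, hk, hmk⟩ : ∃ k : ℕ, k ≤ 1 ∧ eigenMultiplicity Y φ (Complex.I * (Real.sqrt d : ℂ)) + 2 * k = 3 := by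
    rcases h31 with h | h
    · exact ⟨0, zero_le_one, by omega⟩
    · exact ⟨1, le_rfl, by omega⟩
  obtain ⟨E₀, ψ₀, hE, hψ₀, hm₀⟩ := exists_cmCurve_eigenMultiplicity_eq d hd hk
  have hdim : (Y.prod (E₀.prod E₀)).dim = 2 * 3 := by
    rw [AbelianVariety.dim_prod, AbelianVariety.dim_prod, hY, hE]
  refine ⟨E₀, ψ₀, hE, hψ₀, isWeilType_of_eigenMultiplicity_eq three_pos hd hdim
    (prodLift_comp_self_eq_neg_nsmul hφ (prodLift_comp_self_eq_neg_nsmul hψ₀ hψ₀)) ?_⟩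
  rw [eigenMultiplicity_prodLift, eigenMultiplicity_prodLift, hm₀]
  omega

end Balancing

/-! ## §2 Pointwise-rational ⟹ whole complexified Weil plane, on a Weil-type pair (unconditional) -/

section Bridge

variable {A : AbelianVariety ℂ} {φ : A ⟶ A} {n d : ℕ}

/-- **On a Weil-type pair, `WeilAlgebraicFor` (every RATIONAL `(n,n)` Weil class algebraic — the shape of the
layer's printed facts) gives `weilClassesOf A φ n d ⊆ Nⁿ H²ⁿ` (the WHOLE complexified Weil plane — the shape
consumed by the coniveau transfer):** the Weil plane of a Weil-type pair is spanned by rational classes of Hodge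
type `(n,n)` (`weilClassesOf_le_algebraicClasses_of_forall_isRationalClass`, van Geemen 4.9–4.10 with Deligne–Milne
Prop. 4.4, balanced multiplicity from `IsWeilType.multiplicity_eq`).
[cite: vanGeemen1994HodgeAV, 4.9–4.10 and Lemma 5.2 (6)] [cite: Deligne1982HodgeCycles, §4 Prop. 4.4] -/
theorem weilClassesOf_le_algebraicClasses_of_weilAlgebraicFor (hW : IsWeilType A φ n d)
    (h : WeilAlgebraicFor n d A φ) : weilClassesOf A φ n d ≤ algebraicClasses A.X n :=
  weilClassesOf_le_algebraicClasses_of_forall_isRationalClass hW.pos hW.dim_eq hW.d_pos hW.sq_eq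
    hW.multiplicity_eq (fun c hcQ hcH hw ↦ h c hw hcQ hcH)

end Bridge

/-! ## §3 Prop. G31 with the hyperbolicity hypothesis replaced by Weil type `(3,3)` of `Y × E₀²` -/

section G31

variable {Y E₀ : AbelianVariety ℂ} {d : ℕ} {φ : Y ⟶ Y} {ψ₀ : E₀ ⟶ E₀}

/-- `dim (E₀ × E₀) = 2` for a curve `E₀`. [folklore] -/
private theorem dim_cmSquare (hE : E₀.dim = 1) : (E₀.prod E₀).dim = 2 := by
  rw [AbelianVariety.dim_prod, hE]

/-- **G31 for `K = ℚ(√-d)`, any `d ≥ 1`, from Markman's F2 ALONE (UNREFEREED named fact `hM`), hyperbolicity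
discharged:** `Y` a fourfold, `E₀` a curve, `φ² = -d` on `Y`, `ψ₀² = -d` on `E₀`, and `(Y × (E₀ × E₀), φ × (ψ₀ × ψ₀))`
of Weil type `(3,3)`; then `weilClassesOf Y φ 2 d ⊆ N¹ H⁴(Y(ℂ); ℂ)`. Chain: atlas-2's
`weilAlgebraicFor_three_fourfold_prod_curve_sq_of_markmanSixfolds` (re-association to the fivefold-times-curve
`(Y × E₀) × E₀`, SPLIT by the AbelianAll seat's `isSplitWeilType_odd_prod_curve`, F2 applied directly) ⟶ §2 ⟶ the
coniveau transfer `weilClassesOf_fourfold_le_supportedClasses_one`.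
[cite: Markman2025SecantWeil, Thm. 1.5.1 (preprint, unrefereed)] [cite: GrothendieckTopology1969, p. 301]
[cite: Abdulali2016TateTwists, Prop. 3.2 and §8.2 (p. 298)] [cite: vanGeemen1994HodgeAV, Lemma 5.2 (2)–(4), 5.4 and (5.4.1)] -/
theorem weilClassesOf_fourfold_le_supportedClasses_one_of_markman_of_isWeilType
    (hM : Markman2025_weilClasses_algebraic_hyperbolicSixfold) (hY : Y.dim = 4) (hE : E₀.dim = 1) (hd : 0 < d)
    (hφ : φ ≫ φ = -(d • 𝟙 Y)) (hψ₀ : ψ₀ ≫ ψ₀ = -(d • 𝟙 E₀))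
    (hW : IsWeilType (Y.prod (E₀.prod E₀))
      (AbelianVariety.prodLift (AbelianVariety.fst Y (E₀.prod E₀) ≫ φ)
        (AbelianVariety.snd Y (E₀.prod E₀) ≫
          AbelianVariety.prodLift (AbelianVariety.fst E₀ E₀ ≫ ψ₀) (AbelianVariety.snd E₀ E₀ ≫ ψ₀))) 3 d) :
    weilClassesOf Y φ 2 d ≤ supportedClasses Y.X 4 1 :=
  weilClassesOf_fourfold_le_supportedClasses_one hd hY (dim_cmSquare hE) φ
    (prodLift_comp_self_eq_neg_nsmul hψ₀ hψ₀)
    (weilClassesOf_le_algebraicClasses_of_weilAlgebraicFor hW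
      (weilAlgebraicFor_three_fourfold_prod_curve_sq_of_markmanSixfolds hM hY hE hd hφ hψ₀ hW))

/-- **G31 for `K = ℚ(i)` from Koike 2004 ALONE (REFEREED named fact `hK`), hyperbolicity discharged:** as above
with `φ² = -1`, `ψ₀² = -1`. [cite: Koike2004WeilHodge, Thm. 2.1 and Cor. 2.1] [cite: GrothendieckTopology1969, p. 301]
[cite: Abdulali2016TateTwists, Prop. 3.2 and §8.2 (p. 298)] [cite: vanGeemen1994HodgeAV, (5.4.1)] -/
theorem weilClassesOf_fourfold_le_supportedClasses_one_of_koike_of_isWeilType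
    (hK : Koike2004_weilClasses_algebraic_hyperbolicSixfold_one) (hY : Y.dim = 4) (hE : E₀.dim = 1)
    (hφ : φ ≫ φ = -((1 : ℕ) • 𝟙 Y)) (hψ₀ : ψ₀ ≫ ψ₀ = -((1 : ℕ) • 𝟙 E₀))
    (hW : IsWeilType (Y.prod (E₀.prod E₀))
      (AbelianVariety.prodLift (AbelianVariety.fst Y (E₀.prod E₀) ≫ φ)
        (AbelianVariety.snd Y (E₀.prod E₀) ≫
          AbelianVariety.prodLift (AbelianVariety.fst E₀ E₀ ≫ ψ₀) (AbelianVariety.snd E₀ E₀ ≫ ψ₀))) 3 1) :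
    weilClassesOf Y φ 2 1 ≤ supportedClasses Y.X 4 1 :=
  weilClassesOf_fourfold_le_supportedClasses_one one_pos hY (dim_cmSquare hE) φ
    (prodLift_comp_self_eq_neg_nsmul hψ₀ hψ₀)
    (weilClassesOf_le_algebraicClasses_of_weilAlgebraicFor hW
      (weilAlgebraicFor_three_fourfold_prod_curve_sq_of_koike hK hY hE hφ hψ₀ hW))

/-- **G31 for `K = ℚ(√-3)` from Schoen 1998 ALONE (REFEREED named fact `hS`), hyperbolicity discharged:** as above
with `φ² = -3`, `ψ₀² = -3`. [cite: Schoen1998HodgeWeilAddendum, §§10–13] [cite: Schoen1988HodgeWeil, Thm. 3.0 and p. 30]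
[cite: GrothendieckTopology1969, p. 301] [cite: Abdulali2016TateTwists, Prop. 3.2, §8.2 (p. 298) and Appendix A] -/
theorem weilClassesOf_fourfold_le_supportedClasses_one_of_schoen1998_of_isWeilType
    (hS : Schoen1998_weilClasses_algebraic_hyperbolicSixfold_three) (hY : Y.dim = 4) (hE : E₀.dim = 1)
    (hφ : φ ≫ φ = -((3 : ℕ) • 𝟙 Y)) (hψ₀ : ψ₀ ≫ ψ₀ = -((3 : ℕ) • 𝟙 E₀))
    (hW : IsWeilType (Y.prod (E₀.prod E₀))
      (AbelianVariety.prodLift (AbelianVariety.fst Y (E₀.prod E₀) ≫ φ)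
        (AbelianVariety.snd Y (E₀.prod E₀) ≫
          AbelianVariety.prodLift (AbelianVariety.fst E₀ E₀ ≫ ψ₀) (AbelianVariety.snd E₀ E₀ ≫ ψ₀))) 3 3) :
    weilClassesOf Y φ 2 3 ≤ supportedClasses Y.X 4 1 :=
  weilClassesOf_fourfold_le_supportedClasses_one (by norm_num) hY (dim_cmSquare hE) φ
    (prodLift_comp_self_eq_neg_nsmul hψ₀ hψ₀)
    (weilClassesOf_le_algebraicClasses_of_weilAlgebraicFor hW
      (weilAlgebraicFor_three_fourfold_prod_curve_sq_of_schoen hS hY hE hφ hψ₀ hW))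

end G31

/-! ## §4 Headline: the general Hodge conjecture (coniveau 1) for `W_K(Y)`, `Y` any abelian fourfold of `K`-signature `(3,1)` -/

section Headline

variable {Y : AbelianVariety ℂ} {d : ℕ} {φ : Y ⟶ Y}

/-- **GHC (coniveau 1) for the Weil Hodge structure of every abelian fourfold of `K`-signature `(3,1)`, any
`K = ℚ(√-d)`, granted Markman's F2 ALONE (UNREFEREED named fact `hM`).** `Y` an abelian fourfold, `φ ≫ φ = -d`,
`d ≥ 1`, `i√d` of multiplicity `3` or `1` on `H^{1,0}(Y)`; then `weilClassesOf Y φ 2 d ⊆ N¹ H⁴(Y(ℂ); ℂ)` — every class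
of the complexified Weil plane `W_K(Y) ⊗ ℂ` (Hodge types `(3,1)`, `(1,3)`) is supported on a divisor, as the general
Hodge conjecture predicts. §1 supplies the balancing CM square, §3 the rest.
[cite: Markman2025SecantWeil, Thm. 1.5.1 (preprint, unrefereed)] [cite: GrothendieckTopology1969, p. 301]
[cite: Abdulali2016TateTwists, Prop. 3.2, §8.2 (p. 298) and Appendix A] [cite: vanGeemen1994HodgeAV, 5.3, 5.4 and (5.4.1)] -/
theorem weilClassesOf_fourfold31_le_supportedClasses_one_of_markman
    (hM : Markman2025_weilClasses_algebraic_hyperbolicSixfold) (hY : Y.dim = 4) (hd : 0 < d)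
    (hφ : φ ≫ φ = -(d • 𝟙 Y))
    (h31 : eigenMultiplicity Y φ (Complex.I * (Real.sqrt d : ℂ)) = 3 ∨
      eigenMultiplicity Y φ (Complex.I * (Real.sqrt d : ℂ)) = 1) :
    weilClassesOf Y φ 2 d ≤ supportedClasses Y.X 4 1 := by
  obtain ⟨E₀, ψ₀, hE, hψ₀, hW⟩ := exists_isWeilType_fourfold31_prod_cmSquare hd hY hφ h31
  exact weilClassesOf_fourfold_le_supportedClasses_one_of_markman_of_isWeilType hM hY hE hd hφ hψ₀ hW

/-- **GHC (coniveau 1) for the Weil Hodge structure of every abelian fourfold of `ℚ(i)`-signature `(3,1)`, granted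
Koike 2004 ALONE (REFEREED named fact `hK`)** — in print a theorem of Schoen (1989, cyclic covers; Abdulali 2016 §8.2
case 1); here a second proof on the carriers. [cite: Koike2004WeilHodge, Thm. 2.1 and Cor. 2.1]
[cite: GrothendieckTopology1969, p. 301] [cite: Abdulali2016TateTwists, §8.2 (p. 298)] [cite: vanGeemen1994HodgeAV, 5.3 and (5.4.1)] -/
theorem weilClassesOf_fourfold31_le_supportedClasses_one_of_koike
    (hK : Koike2004_weilClasses_algebraic_hyperbolicSixfold_one) (hY : Y.dim = 4)
    (hφ : φ ≫ φ = -((1 : ℕ) • 𝟙 Y))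
    (h31 : eigenMultiplicity Y φ (Complex.I * (Real.sqrt (1 : ℕ) : ℂ)) = 3 ∨
      eigenMultiplicity Y φ (Complex.I * (Real.sqrt (1 : ℕ) : ℂ)) = 1) :
    weilClassesOf Y φ 2 1 ≤ supportedClasses Y.X 4 1 := by
  obtain ⟨E₀, ψ₀, hE, hψ₀, hW⟩ := exists_isWeilType_fourfold31_prod_cmSquare one_pos hY hφ h31
  exact weilClassesOf_fourfold_le_supportedClasses_one_of_koike_of_isWeilType hK hY hE hφ hψ₀ hW

/-- **GHC (coniveau 1) for the Weil Hodge structure of every abelian fourfold of `ℚ(√-3)`-signature `(3,1)`, granted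
Schoen 1998 ALONE (REFEREED named fact `hS`)** — a case for which the surveyed print literature (Abdulali 2016 §8.2
and Appendix A) records no proof; decided here from one refereed input. [cite: Schoen1998HodgeWeilAddendum, §§10–13]
[cite: Schoen1988HodgeWeil, Thm. 3.0 and p. 30] [cite: GrothendieckTopology1969, p. 301]
[cite: Abdulali2016TateTwists, §8.2 (p. 298) and Appendix A] [cite: vanGeemen1994HodgeAV, 5.3, 7.3 and (5.4.1)] -/
theorem weilClassesOf_fourfold31_le_supportedClasses_one_of_schoen1998
    (hS : Schoen1998_weilClasses_algebraic_hyperbolicSixfold_three) (hY : Y.dim = 4)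
    (hφ : φ ≫ φ = -((3 : ℕ) • 𝟙 Y))
    (h31 : eigenMultiplicity Y φ (Complex.I * (Real.sqrt (3 : ℕ) : ℂ)) = 3 ∨
      eigenMultiplicity Y φ (Complex.I * (Real.sqrt (3 : ℕ) : ℂ)) = 1) :
    weilClassesOf Y φ 2 3 ≤ supportedClasses Y.X 4 1 := by
  obtain ⟨E₀, ψ₀, hE, hψ₀, hW⟩ := exists_isWeilType_fourfold31_prod_cmSquare (by norm_num) hY hφ h31
  exact weilClassesOf_fourfold_le_supportedClasses_one_of_schoen1998_of_isWeilType hS hY hE hφ hψ₀ hW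

end Headline

end Summit.HodgeConjecture.HodgeConjecture.Ring2.Motiv

end
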